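import Summits.QuantumFields.YangMills.Theorems.CovariantDischargeDoorSignalRows
import HarnessLib

/-!
# Line «sandwich_discharge» on crux `HistoryTailL` (stmt-QuantumFields-19936), stub `stub_sandwichSweepGapCapped` (S′), B6 door — the two (η)-GUARD rows of the
# D6-MEANS leaves: «THE LOCALISED-READING GUARD `81·ℓ·(4ℓ)^k·β_k ≤ 1` HOLDS AT BOTH HEIGHTS PAST ONE DEPTH THRESHOLD»

Cell `ym3-torus` (YM ladder rung R3 = continuum SU(2) Yang–Mills on the three-torus — a RUNG, NOT the Clay problem); width seat `ym3-torus-px18` gen 6;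
`--supports stmt-QuantumFields-19936` (helper).  THEOREMS ONLY (0 `def`, 0 `sorry`, default heartbeats).  Sibling of `CovariantDischargeDoorMeans` (the (S3)(S4)
leaves `door_mean_le` ∕ `door_mean_far_le` of px8's DOOR SKELETON), whose ONE extra hypothesis per height is the reading lemma's guard
`81·ℓ·((4ℓ)^k·β_k) ≤ 1`, `ℓ = (d+2)L`, `β_k = ((2d(4L^k+2)+2)²∕4)·θK`.  At `d = 3` (`ℓ = 5L`, `4ℓ = 20L`, `β_k = (12L^k+7)²θK ≤ 175L^{2k}θK` for `L^k ≥ 6`,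
✓`CovariantDischargeDoorSignalRows.beta_le`) and under the door's two standing rows — the threshold RATIO `θK ≤ 2^{p₀}·√(L⁻¹)^j·θ` (✓`CovariantDischargeThresholdRatio`)
and the CAP `θ ≤ x ≤ (151·L²·(L⁻¹)^19)^j` (✓`CovariantDischargeSandwichCapThreshold`, `M = 19`) — the guard's left side at height `k = j + n` is
`≤ 70875·2^{p₀}·(20^n·L^{3n})·3020^j ∕ L^{13j}` (`thetaK_le_cap`, ★`guard_factor_le`), which px6's template ✓`exists_forall_row_le` makes `≤ ε` past a `j₀`
(`3020 < 3^13`; ★`exists_forall_guardFactor_le`); ★`guard_le_one` ∕ `guard_far_le_one` are the two hypotheses of `door_mean_le` ∕ `door_mean_far_le` in the door's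
letters (`n = 0` and `n = m`, `h = j + m`), and ★`exists_j1_guards` is the pair of rows for the skeleton's `hj₀` slot.
HONEST SCOPE: real arithmetic; NOTHING here proves the other leaves of the door, the capped stub, `HistoryTailL`, or any summit statement; YM₃ on T³ is rung R3, not Clay.
[folklore]
-/

set_option autoImplicit false

noncomputable section

namespace Summit.QuantumFields.YangMills.Theorems.CovariantDischargeDoorGuardRows

open Summit.QuantumFields.YangMills.Theorems.CovariantDischargeDoorExponentRows (cap_pow_eq exists_forall_row_le)
open Summit.QuantumFields.YangMills.Theorems.CovariantDischargeDoorThresholdJ0 (eventually_and)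
open Summit.QuantumFields.YangMills.Theorems.CovariantDischargeDoorSignalRows (beta_le four_mul_cast_eq)

variable {L : ℕ} {p₀ θ x θK : ℝ} {j : ℕ}

/-- **`θK ≤ 2^{p₀}·151^j∕L^(17j)`** from the ratio `θK ≤ 2^{p₀}·√(L⁻¹)^j·θ` and the CAP `θ ≤ x ≤ (151·L²·(L⁻¹)^19)^j` (drop `√(L⁻¹)^j ≤ 1`). [folklore] -/
theorem thetaK_le_cap (hL : 1 ≤ L) (hθ : 0 ≤ θ) (hθx : θ ≤ x) (hθK : θK ≤ (2 : ℝ) ^ p₀ * Real.sqrt ((L : ℝ)⁻¹) ^ j * θ)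
    (hx : x ≤ (151 * (L : ℝ) ^ 2 * ((L : ℝ)⁻¹) ^ 19) ^ j) :
    θK ≤ (2 : ℝ) ^ p₀ * ((151 : ℝ) ^ j / (L : ℝ) ^ (17 * j)) := by
  have hL1 : (1 : ℝ) ≤ L := by exact_mod_cast hL
  have hq1 : Real.sqrt ((L : ℝ)⁻¹) ^ j ≤ 1 := by
    refine pow_le_one₀ (Real.sqrt_nonneg _) ?_
    rw [Real.sqrt_le_one]
    exact inv_le_one_of_one_le₀ hL1
  have h2p : (0 : ℝ) ≤ (2 : ℝ) ^ p₀ := by positivity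
  calc θK ≤ (2 : ℝ) ^ p₀ * Real.sqrt ((L : ℝ)⁻¹) ^ j * θ := hθK
    _ ≤ (2 : ℝ) ^ p₀ * 1 * θ := by
        refine mul_le_mul_of_nonneg_right ?_ hθ
        exact mul_le_mul_of_nonneg_left hq1 h2p
    _ ≤ (2 : ℝ) ^ p₀ * x := by rw [mul_one]; exact mul_le_mul_of_nonneg_left hθx h2p
    _ ≤ (2 : ℝ) ^ p₀ * (151 * (L : ℝ) ^ 2 * ((L : ℝ)⁻¹) ^ 19) ^ j := mul_le_mul_of_nonneg_left hx h2p
    _ = (2 : ℝ) ^ p₀ * ((151 : ℝ) ^ j / (L : ℝ) ^ (17 * j)) := by rw [cap_pow_eq hL]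

/-- ★ **THE GUARD FACTOR ROW AT HEIGHT `k = j + n`** (`d = 3`: `ℓ = 5L`, `4ℓ = 20L`, `β_k = (12L^k+7)²θK`): with `L^k ≥ 6`, `1 ≤ j`, the ratio and the CAP,
`81·ℓ·((4ℓ)^k·β_k) ≤ 70875·2^{p₀}·(20^n·L^{3n})·3020^j ∕ L^{13j}`  (`81·5·175 = 70875`, `20·151 = 3020`, `L·L^{3j} ≤ L^{4j}`). [folklore] -/
theorem guard_factor_le {k n : ℕ} (hL : 1 ≤ L) (hk : k = j + n) (hj : 1 ≤ j) (hLk : (6 : ℝ) ≤ (L : ℝ) ^ k) (hθ : 0 ≤ θ) (hθx : θ ≤ x)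
    (hθK0 : 0 ≤ θK) (hθK : θK ≤ (2 : ℝ) ^ p₀ * Real.sqrt ((L : ℝ)⁻¹) ^ j * θ) (hx : x ≤ (151 * (L : ℝ) ^ 2 * ((L : ℝ)⁻¹) ^ 19) ^ j) :
    81 * ((((3 + 2) * L : ℕ) : ℝ)) * ((4 * ((((3 + 2) * L : ℕ) : ℝ))) ^ k * ((((2 * 3 * (4 * L ^ k + 2) + 2 : ℕ) : ℝ) ^ 2 / 4) * θK))
      ≤ 70875 * (2 : ℝ) ^ p₀ * ((20 : ℝ) ^ n * (L : ℝ) ^ (3 * n)) * (3020 : ℝ) ^ j / (L : ℝ) ^ (13 * j) := by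
  have hL1 : (1 : ℝ) ≤ L := by exact_mod_cast hL
  have hL0 : (0 : ℝ) < L := by linarith
  have h2p : (0 : ℝ) ≤ (2 : ℝ) ^ p₀ := by positivity
  rw [four_mul_cast_eq]
  have hℓ : ((((3 + 2) * L : ℕ) : ℝ)) = 5 * (L : ℝ) := by push_cast; ring
  rw [hℓ]
  have hβ := beta_le hLk hθK0
  have hθK' := thetaK_le_cap hL hθ hθx hθK hx
  -- (1) the door's letters against `70875·L·20^k·L^{3k}·θK`
  have step1 : 81 * (5 * (L : ℝ)) * ((20 * (L : ℝ)) ^ k * ((((2 * 3 * (4 * L ^ k + 2) + 2 : ℕ) : ℝ) ^ 2 / 4) * θK))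
      ≤ 70875 * (L : ℝ) * (20 : ℝ) ^ k * (L : ℝ) ^ (3 * k) * θK := by
    have h1 : (20 * (L : ℝ)) ^ k * ((((2 * 3 * (4 * L ^ k + 2) + 2 : ℕ) : ℝ) ^ 2 / 4) * θK)
        ≤ (20 * (L : ℝ)) ^ k * (175 * (L : ℝ) ^ (2 * k) * θK) := mul_le_mul_of_nonneg_left hβ (by positivity)
    have h2 := mul_le_mul_of_nonneg_left h1 (by positivity : (0 : ℝ) ≤ 81 * (5 * (L : ℝ)))
    have e : 81 * (5 * (L : ℝ)) * ((20 * (L : ℝ)) ^ k * (175 * (L : ℝ) ^ (2 * k) * θK)) =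
        70875 * (L : ℝ) * (20 : ℝ) ^ k * (L : ℝ) ^ (3 * k) * θK := by
      rw [mul_pow, show (L : ℝ) ^ (3 * k) = (L : ℝ) ^ k * (L : ℝ) ^ (2 * k) by rw [← pow_add]; ring_nf]
      ring
    linarith
  -- (2) the threshold against the CAP
  have step2 : 70875 * (L : ℝ) * (20 : ℝ) ^ k * (L : ℝ) ^ (3 * k) * θK
      ≤ 70875 * (L : ℝ) * (20 : ℝ) ^ k * (L : ℝ) ^ (3 * k) * ((2 : ℝ) ^ p₀ * ((151 : ℝ) ^ j / (L : ℝ) ^ (17 * j))) :=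
    mul_le_mul_of_nonneg_left hθK' (by positivity)
  -- (3) exponent bookkeeping at `k = j + n`: the product is `RHS · (L ∕ L^j) ≤ RHS`
  have step3 : 70875 * (L : ℝ) * (20 : ℝ) ^ k * (L : ℝ) ^ (3 * k) * ((2 : ℝ) ^ p₀ * ((151 : ℝ) ^ j / (L : ℝ) ^ (17 * j)))
      ≤ 70875 * (2 : ℝ) ^ p₀ * ((20 : ℝ) ^ n * (L : ℝ) ^ (3 * n)) * (3020 : ℝ) ^ j / (L : ℝ) ^ (13 * j) := by
    subst hk
    have hLj : (L : ℝ) ≤ (L : ℝ) ^ j := le_self_pow₀ hL1 (by omega)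
    have e1 : (20 : ℝ) ^ (j + n) = (20 : ℝ) ^ j * (20 : ℝ) ^ n := pow_add _ _ _
    have e2 : (L : ℝ) ^ (3 * (j + n)) = (L : ℝ) ^ (3 * j) * (L : ℝ) ^ (3 * n) := by rw [← pow_add]; ring_nf
    have e3 : (L : ℝ) ^ (17 * j) = (L : ℝ) ^ (13 * j) * (L : ℝ) ^ (3 * j) * (L : ℝ) ^ j := by rw [← pow_add, ← pow_add]; ring_nf
    have e4 : (3020 : ℝ) ^ j = (20 : ℝ) ^ j * (151 : ℝ) ^ j := by rw [← mul_pow]; norm_num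
    have hne : (L : ℝ) ^ j ≠ 0 := pow_ne_zero _ hL0.ne'
    have hne3 : (L : ℝ) ^ (3 * j) ≠ 0 := pow_ne_zero _ hL0.ne'
    have hne13 : (L : ℝ) ^ (13 * j) ≠ 0 := pow_ne_zero _ hL0.ne'
    have hA : 70875 * (L : ℝ) * (20 : ℝ) ^ (j + n) * (L : ℝ) ^ (3 * (j + n)) * ((2 : ℝ) ^ p₀ * ((151 : ℝ) ^ j / (L : ℝ) ^ (17 * j)))
        = (70875 * (2 : ℝ) ^ p₀ * ((20 : ℝ) ^ n * (L : ℝ) ^ (3 * n)) * (3020 : ℝ) ^ j / (L : ℝ) ^ (13 * j)) * ((L : ℝ) / (L : ℝ) ^ j) := by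
      rw [e1, e2, e3, e4]
      field_simp
    rw [hA]
    exact mul_le_of_le_one_right (by positivity) (div_le_one_of_le₀ hLj (by positivity))
  exact step1.trans (step2.trans step3)

/-- ★ **THE GUARD FACTOR IS EVENTUALLY `≤ ε`** (`L ≥ 3`; `3020 < 3^13`): px6's template ✓`exists_forall_row_le`. [folklore] -/
theorem exists_forall_guardFactor_le (hL : 3 ≤ L) (p₀ : ℝ) (n : ℕ) {ε : ℝ} (hε : 0 < ε) :
    ∃ j₀ : ℕ, ∀ j : ℕ, j₀ < j → 70875 * (2 : ℝ) ^ p₀ * ((20 : ℝ) ^ n * (L : ℝ) ^ (3 * n)) * (3020 : ℝ) ^ j / (L : ℝ) ^ (13 * j) ≤ ε :=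
  exists_forall_row_le hL (by norm_num) (by norm_num : (3020 : ℝ) < (3 : ℝ) ^ 13) _ _ hε

/-- ★ **THE GUARD AT THE SIGNAL HEIGHT `j`** — the hypothesis `hguard` of `CovariantDischargeDoorMeans.door_mean_le` in the door's letters (`d = 3`), from the ratio,
the CAP, `L^j ≥ 6`, `1 ≤ j`, and the row `70875·2^{p₀}·(20^0·L^0)·3020^j∕L^{13j} ≤ 1` of the `hj₀` slot. [folklore] -/
theorem guard_le_one (hL : 1 ≤ L) (hj : 1 ≤ j) (hLj : (6 : ℝ) ≤ (L : ℝ) ^ j) (hθ : 0 ≤ θ) (hθx : θ ≤ x) (hθK0 : 0 ≤ θK)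
    (hθK : θK ≤ (2 : ℝ) ^ p₀ * Real.sqrt ((L : ℝ)⁻¹) ^ j * θ) (hx : x ≤ (151 * (L : ℝ) ^ 2 * ((L : ℝ)⁻¹) ^ 19) ^ j)
    (hrow : 70875 * (2 : ℝ) ^ p₀ * ((20 : ℝ) ^ 0 * (L : ℝ) ^ (3 * 0)) * (3020 : ℝ) ^ j / (L : ℝ) ^ (13 * j) ≤ 1) :
    81 * ((((3 + 2) * L : ℕ) : ℝ)) * ((4 * ((((3 + 2) * L : ℕ) : ℝ))) ^ j * ((((2 * 3 * (4 * L ^ j + 2) + 2 : ℕ) : ℝ) ^ 2 / 4) * θK)) ≤ 1 :=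
  (guard_factor_le hL (Nat.add_zero j).symm hj hLj hθ hθx hθK0 hθK hx).trans hrow

/-- ★ **THE GUARD AT THE FAR HEIGHT `h = j + m`** — the hypothesis `hguard` of `CovariantDischargeDoorMeans.door_mean_far_le` in the door's letters (`d = 3`), from the
ratio, the CAP, `L^h ≥ 6`, `1 ≤ j`, and the row `70875·2^{p₀}·(20^m·L^{3m})·3020^j∕L^{13j} ≤ 1` of the `hj₀` slot. [folklore] -/
theorem guard_far_le_one {m h : ℕ} (hL : 1 ≤ L) (hh : h = j + m) (hj : 1 ≤ j) (hLh : (6 : ℝ) ≤ (L : ℝ) ^ h) (hθ : 0 ≤ θ) (hθx : θ ≤ x)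
    (hθK0 : 0 ≤ θK) (hθK : θK ≤ (2 : ℝ) ^ p₀ * Real.sqrt ((L : ℝ)⁻¹) ^ j * θ) (hx : x ≤ (151 * (L : ℝ) ^ 2 * ((L : ℝ)⁻¹) ^ 19) ^ j)
    (hrow : 70875 * (2 : ℝ) ^ p₀ * ((20 : ℝ) ^ m * (L : ℝ) ^ (3 * m)) * (3020 : ℝ) ^ j / (L : ℝ) ^ (13 * j) ≤ 1) :
    81 * ((((3 + 2) * L : ℕ) : ℝ)) * ((4 * ((((3 + 2) * L : ℕ) : ℝ))) ^ h * ((((2 * 3 * (4 * L ^ h + 2) + 2 : ℕ) : ℝ) ^ 2 / 4) * θK)) ≤ 1 :=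
  (guard_factor_le hL hh hj hLh hθ hθx hθK0 hθK hx).trans hrow

/-- ★ **BOTH GUARD ROWS PAST ONE THRESHOLD** — the pair of conjuncts for the skeleton's `hj₀` slot (`L ≥ 3`): `∃ j₁, ∀ j > j₁`, the `n = 0` row and the `n = m` row
are `≤ 1`. [folklore] -/
theorem exists_j1_guards (hL : 3 ≤ L) (p₀ : ℝ) (m : ℕ) :
    ∃ j₁ : ℕ, ∀ j : ℕ, j₁ < j →
      70875 * (2 : ℝ) ^ p₀ * ((20 : ℝ) ^ 0 * (L : ℝ) ^ (3 * 0)) * (3020 : ℝ) ^ j / (L : ℝ) ^ (13 * j) ≤ 1 ∧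
      70875 * (2 : ℝ) ^ p₀ * ((20 : ℝ) ^ m * (L : ℝ) ^ (3 * m)) * (3020 : ℝ) ^ j / (L : ℝ) ^ (13 * j) ≤ 1 :=
  eventually_and (exists_forall_guardFactor_le hL p₀ 0 one_pos) (exists_forall_guardFactor_le hL p₀ m one_pos)

end Summit.QuantumFields.YangMills.Theorems.CovariantDischargeDoorGuardRows

end
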